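import Mathlib.RingTheory.MvPolynomial.Homogeneous
import Mathlib.Algebra.MvPolynomial.PDeriv
import Mathlib.LinearAlgebra.Matrix.Determinant.Basic
import Mathlib.AlgebraicGeometry.Birational.RationalMap
import Literature.AlgebraicGeometry.Motives.CompleteIntersection
import Literature.AlgebraicGeometry.Motives.SmoothHypersurfaceScheme
import HarnessLib

/-!
# Delsarte polynomials, invertible polynomials and pencils, Delsarte complete intersections

Topic `AlgebraicGeometry/Motives`. Vocabulary requested by route `HodgeConjecture/KatzUnwinding`
(definition item `defn-IsDelsarteCompleteIntersection`, for the informal items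
`DelsarteTowerEndgame` / `KummerEndgame` and the glue `DominantDescent`): the "Fermat-domination
endgame" needs to *say* that a variety is a Delsarte hypersurface / complete intersection, that a
polynomial is invertible (Berglund–Hübsch–Krawitz) and belongs to an invertible pencil, and to
*cite* the fact that Delsarte hypersurfaces are dominated by Fermat varieties (Shioda maps).

## Contents (source item → Lean declaration → status)

| source | Lean | status |
|---|---|---|
| `F_A = Σᵢ ∏ⱼ xⱼ^{aᵢⱼ}` [DoranEtAl2018 §1.2; Kloosterman2017 §1] | `Delsarte.polynomial R A` | def + `isHomogeneous_polynomial`, `polynomial_diagonal` (`F_{d·1} = Σ xᵢᵈ` = `fermatPolynomial`) |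
| Shioda map `φ_B : y ↦ x = y^B`, `F_A(y^B) = F_{AB}(y)` [Kelly2013 §3; Kloosterman2017 §2; Shioda1986] | `Delsarte.bind₁_polynomial` | **proved** |
| invertible polynomial (`det A ≠ 0`, quasi-homogeneous, isolated critical point at `0`) [DoranEtAl2018 §1.2] | `IsInvertiblePolynomial A` (+ `Delsarte.IsQuasiHomogeneousWith`, `Delsarte.criticalLocus`) | def; `isInvertiblePolynomial_diagonal` (Fermat type `Σ xᵢᵐ`, `m ≥ 2`) **proved** |
| invertible pencil `F_{A,ψ} = F_A - ψ x₀⋯xₙ` [DoranEtAl2018 §1.2, (1.2.3)]; monomial deformation `F_A - ψ ∏ xⱼ^{aⱼ}` [Kloosterman2017 Def. 2.5; Katz2009 §1] | `Delsarte.pencil`, `Delsarte.deformation` | defs + `isHomogeneous_pencil` (Calabi–Yau row sums), `pencil_diagonal` (the Dwork pencil `Σ xᵢᵈ - ψ ∏ xᵢ`) |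
| Delsarte hypersurface (coefficient matrix: `det A ≠ 0`, positive weights, a zero in each column) [Kloosterman2017 Def. 2.1, 2.5; Shioda1986] | `IsDelsarteHypersurface n X` | def; `IsFermatVariety.isDelsarteHypersurface`, `isDelsarteHypersurface_hypersurface_fermat` **proved** (non-vacuity) |
| Delsarte complete intersection (square invertible total exponent matrix, `r` block equations, expected dimension) [route KatzUnwinding; `r = 1` = Kloosterman2017 Def. 2.5] | `IsDelsarteCompleteIntersection N r X` (+ `Delsarte.blockPolynomial`) | def; `IsDelsarteHypersurface.isDelsarteCompleteIntersection` (`r = 1`) **proved** |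
| Fermat cover: `X_A` is birational to `X_{dI}/G`, `G` finite diagonal; `Y* → X*` surjective [Kelly2013 Thm 3.1 = Bini2011 Thm 3.1; Kloosterman2017 §2; Shioda1986] | `DelsarteFermatCover` | named fact (`def … : Prop`, D-0014), vendored as the *dominant rational map* consequence |

## Sources read

* [DoranEtAl2018] C. F. Doran, T. L. Kelly, A. Salerno, S. Sperber, J. Voight, U. Whitcher, *Zeta
  functions of alternate mirror Calabi–Yau families*, Israel J. Math. 228 (2018), §1.2
  (arXiv:1612.09249, read pp. 3–4): invertible polynomial, dual weights, invertible pencil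
  `F_{A,ψ} = Σᵢ ∏ⱼ xⱼ^{aᵢⱼ} - dᵀψ x₀⋯xₙ`, Kreuzer–Skarke atomic types.
* [Kloosterman2017] R. Kloosterman, *Zeta functions of monomial deformations of Delsarte
  hypersurfaces*, SIGMA 13 (2017) 087, §§1–2 (arXiv:1706.01626, read pp. 2, 4): Def. 2.1
  (coefficient matrix, map matrix `B = dA⁻¹`, weight vector `B(1,…,1)ᵀ`, deformation vector),
  Def. 2.5 (Delsarte hypersurface `X_0`, monomial deformation `X_λ`), the rational (Galois) map
  `Y_λ ⇢ X_λ` from the Fermat deformation `Σ yᵢᵈ + λ ∏ yᵢ^{bᵢ}`, Lemma 2.4 and the surjections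
  `Y*_λ → X*_λ` on torus parts.
* [Kelly2013] T. L. Kelly, *Berglund–Hübsch–Krawitz mirrors via Shioda maps*, ATMP 17 (2013), §§2–3
  (arXiv:1304.3417, read pp. 5, 8–9): the Shioda maps `φ_B`, `φ_{Bᵀ}`, `F_{dI}`, Thm. 3.1
  (= [Bini2011, Thm. 3.1]): `X_A` and `X_{Aᵀ}` are birational to quotients of the Fermat variety
  `X_{dI}` by finite diagonal groups.
* [Shioda1986] T. Shioda, Amer. J. Math. 108 (1986), 415–432 (Delsarte surfaces; the origin of the
  Shioda map) — cited through the three sources above (not held).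

## Design notes

* Everything algebraic is over an arbitrary commutative (semi)ring `R` and arbitrary finite index
  types (`A : Matrix ι σ ℕ`: `ι` monomials, `σ` variables); the sources take `A ∈ M_{n+1}(ℤ_{≥0})`
  square, which is the case `ι = σ = Fin (n + 1)`. Coefficients other than `1` are not allowed
  (over an algebraically closed field they can be scaled away when `det A ≠ 0`).
* The parameter of the pencil is not rescaled: [DoranEtAl2018] write `F_A - dᵀψ x₀⋯xₙ` (`dᵀ` the sum
  of the dual weights), [Kloosterman2017] `F_A + λ ∏ xᵢ^{aᵢ}`; ours is `F_A - ψ · (monomial)`, so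
  their families are `pencil R A (dᵀψ)`, `deformation R A a (-λ)`. The route `DworkPrymHodge` writes
  the Dwork sextic as `(Σ xᵢ⁶) - C (6ψ) ∏ xᵢ = pencil ℂ (6·1) (6ψ)` (`pencil_diagonal`).
* Scheme-side predicates follow `Motives/Sweep1` and `Motives/CompleteIntersection`: a variety
  "is" `V₊(F₁,…,F_r) ⊆ ℙᴺ_k` when it is reduced and admits a closed `k`-immersion onto that closed
  set (`IsHypersurfaceCutOutBy`, `IsCutOutBy`); hypersurfaces of dimension `n` live in `ℙⁿ⁺¹`
  (`n + 2` variables) as for `fermatPolynomial` / `IsFermatVariety`. Being a *complete* intersection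
  is recorded by the expected dimension `schemeDim X + r = N` (the tree's `schemeDim`); the finer
  scheme-theoretic condition (Jacobian / regular sequence) of `IsSmoothCompleteIntersection` is not
  imposed, since the towers of the route are singular in general.
* `IsDelsarteCompleteIntersection` for `r > 1` is NOT a notion from print (the sources treat
  hypersurfaces, `r = 1`); it is the componentwise extension the route asked for, and is flagged as
  such in its docstring. No fact is stated about it.
* `DelsarteFermatCover` is stated with Mathlib's rational maps (`Scheme.PartialMap`, a morphism on a
  dense open) and `IsDominant`; Mathlib has no quotient of a variety by a finite group, so the printed
  "birational to the quotient `X_{dI}/G`" is weakened to "dominated by `X_{dI}` through a rational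
  map", which is what descent arguments (`DominantDescent`) consume. Hypotheses are those of
  [Kloosterman2017, Def. 2.1] in the projective case (constant row sums), with the map matrix given as
  an integer matrix `B` with `A B = d · 1`.

## What is NOT here

Weighted projective spaces (the sources' general setting `X_A ⊆ ℙ(w)`); the BHK dual group and
mirror statements; the domination of Delsarte *complete intersections* or of the *deformed* members
`X_λ` by Fermat-type varieties (Kloosterman's `Y_λ ⇢ X_λ`; only `λ = 0` is vendored); the total space
of a pencil as a scheme over `𝔸¹` (members are handled one `ψ` at a time, as in route
`DworkPrymHodge`); Kreuzer–Skarke's classification.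
-/

noncomputable section

open MvPolynomial

universe u

namespace Literature.AlgebraicGeometry.Motives

namespace Delsarte

section Algebra

variable (R : Type*) [CommSemiring R] {ι σ τ : Type*} [Fintype ι] [Fintype σ] [Fintype τ]

/-- The **Delsarte polynomial** `F_A = Σᵢ ∏ⱼ xⱼ ^ aᵢⱼ` of a matrix of exponents `A = (aᵢⱼ)`
with natural-number entries: one monomial (with coefficient `1`) per row, one variable per
column (Doran–Kelly–Salerno–Sperber–Voight–Whitcher 2018, §1.2; Kloosterman 2017, §1;
Shioda 1986). [cite: DoranEtAl2018, §1.2 (F_A)] -/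
def polynomial (A : Matrix ι σ ℕ) : MvPolynomial σ R :=
  ∑ i, ∏ j, X j ^ A i j

/-- Unfolding `F_A = Σᵢ ∏ⱼ xⱼ ^ aᵢⱼ`. [folklore] -/
theorem polynomial_def (A : Matrix ι σ ℕ) :
    polynomial R A = ∑ i, ∏ j, (X j : MvPolynomial σ R) ^ A i j := rfl

/-- If every row of `A` sums to `d` then `F_A` is homogeneous of degree `d`. [folklore] -/
theorem isHomogeneous_polynomial {A : Matrix ι σ ℕ} {d : ℕ} (h : ∀ i, ∑ j, A i j = d) :
    (polynomial R A).IsHomogeneous d := by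
  refine IsHomogeneous.sum _ _ _ fun i _ => ?_
  rw [← h i]
  refine IsHomogeneous.prod _ _ _ fun j _ => ?_
  simpa using (isHomogeneous_X R j).pow (A i j)

/-- For the diagonal exponent matrix `m · 1`, `F_{m·1} = Σᵢ xᵢᵐ` is the Fermat polynomial
(Kelly 2013, §3: `F_{dI}`). [cite: Kelly2013, §3 (F_dI)] -/
theorem polynomial_diagonal [DecidableEq σ] (m : ℕ) :
    polynomial R (Matrix.diagonal fun _ : σ => m) = ∑ i, (X i : MvPolynomial σ R) ^ m := by
  refine Finset.sum_congr rfl fun i _ => ?_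
  rw [Finset.prod_eq_single i]
  · simp
  · intro j _ hji
    simp [Matrix.diagonal_apply_ne _ hji.symm]
  · simp

/-- **The Shioda substitution.** Substituting the monomials `xⱼ ↦ ∏ₖ yₖ ^ bⱼₖ` of a second
exponent matrix `B` into `F_A` gives `F_{A B}`:
`F_A(y^B) = Σᵢ ∏ₖ yₖ ^ (Σⱼ aᵢⱼ bⱼₖ)`. With `A B = d · 1` (up to a common shift of the rows of `B`)
this is the identity behind the Shioda maps `X_{dI} ⇢ X_A`, `y ↦ x = y^B` (Shioda 1986; Kelly 2013,
§3; Kloosterman 2017, §2). [cite: Kelly2013, §3 (the Shioda map φ_B)] -/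
theorem bind₁_polynomial (A : Matrix ι σ ℕ) (B : Matrix σ τ ℕ) :
    bind₁ (fun j : σ => ∏ k, (X k : MvPolynomial τ R) ^ B j k) (polynomial R A) =
      polynomial R (A * B) := by
  simp only [polynomial, map_sum, map_prod, map_pow, bind₁_X_right]
  refine Finset.sum_congr rfl fun i _ => ?_
  calc (∏ j, (∏ k, (X k : MvPolynomial τ R) ^ B j k) ^ A i j)
      = ∏ j, ∏ k, (X k : MvPolynomial τ R) ^ (B j k * A i j) := by
        refine Finset.prod_congr rfl fun j _ => ?_
        rw [← Finset.prod_pow]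
        exact Finset.prod_congr rfl fun k _ => (pow_mul _ _ _).symm
    _ = ∏ k, ∏ j, (X k : MvPolynomial τ R) ^ (B j k * A i j) := Finset.prod_comm
    _ = ∏ k, (X k : MvPolynomial τ R) ^ (A * B) i k := by
        refine Finset.prod_congr rfl fun k _ => ?_
        rw [Finset.prod_pow_eq_pow_sum, Matrix.mul_apply]
        exact congrArg _ (Finset.sum_congr rfl fun j _ => mul_comm _ _)

/-- `∂ₛ (Σᵢ xᵢᵐ) = m · xₛ^{m-1}` (any finite set of variables; cf.
`SmoothHypersurface.pderiv_sum_X_pow` for `Fin (n + 2)`). [folklore] -/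
theorem pderiv_sum_X_pow (s : σ) (m : ℕ) :
    pderiv s (∑ i : σ, (X i : MvPolynomial σ R) ^ m) = (m : MvPolynomial σ R) * X s ^ (m - 1) := by
  classical
  rw [map_sum, Finset.sum_eq_single s (fun j _ hjs => by
      rw [Derivation.leibniz_pow, pderiv_X_of_ne hjs, smul_zero, smul_zero])
    (fun h => absurd (Finset.mem_univ s) h), Derivation.leibniz_pow, pderiv_X_self]
  simp [nsmul_eq_mul]

end Algebra

section Deformation

variable (R : Type*) [CommRing R] {σ : Type*} [Fintype σ]

/-- The **one-parameter monomial deformation** `F_A - ψ · ∏ⱼ xⱼ ^ aⱼ` of `F_A` by the monomial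
with exponent vector `a` (Kloosterman 2017, Def. 2.2 and 2.5, written there `F_A + λ ∏ xᵢ^{aᵢ}`,
so `λ = -ψ`; Katz 2009, §1, the "generalized Dwork family" for diagonal `A`).
[cite: Kloosterman2017, Def. 2.2 and Def. 2.5 (monomial deformation)] -/
def deformation (A : Matrix σ σ ℕ) (a : σ → ℕ) (ψ : R) : MvPolynomial σ R :=
  polynomial R A - C ψ * ∏ j, X j ^ a j

/-- The **invertible pencil** `F_{A,ψ} = F_A - ψ · x₀ x₁ ⋯ xₙ`, the deformation of `F_A` by the
product of all the variables (Doran et al. 2018, §1.2, where the parameter is normalised as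
`F_A - dᵀ ψ x₀⋯xₙ`, `dᵀ` the sum of the dual weights; here `ψ` is not rescaled, so their
`F_{A,ψ}` is `pencil R A (dᵀ ψ)`). [cite: DoranEtAl2018, §1.2 (invertible pencil F_{A,ψ})] -/
def pencil (A : Matrix σ σ ℕ) (ψ : R) : MvPolynomial σ R :=
  polynomial R A - C ψ * ∏ j, X j

/-- The pencil is the monomial deformation by the exponent vector `(1, …, 1)`. [folklore] -/
theorem pencil_eq_deformation (A : Matrix σ σ ℕ) (ψ : R) :
    pencil R A ψ = deformation R A (fun _ => 1) ψ := by
  simp [pencil, deformation]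

/-- At `ψ = 0` the pencil is `F_A`. [folklore] -/
@[simp]
theorem pencil_zero (A : Matrix σ σ ℕ) : pencil R A 0 = polynomial R A := by
  simp [pencil]

/-- If every row of `A` sums to the number of variables (the Calabi–Yau condition of Doran et al.
2018, §1.2: `F_A` homogeneous of degree `n + 1` in `n + 1` variables), the pencil `F_{A,ψ}` is
homogeneous of that degree. [folklore] -/
theorem isHomogeneous_pencil {A : Matrix σ σ ℕ} (h : ∀ i, ∑ j, A i j = Fintype.card σ) (ψ : R) :
    (pencil R A ψ).IsHomogeneous (Fintype.card σ) := by
  refine (isHomogeneous_polynomial R h).sub ?_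
  have hprod : (∏ j : σ, (X j : MvPolynomial σ R)).IsHomogeneous (Fintype.card σ) := by
    have := IsHomogeneous.prod (Finset.univ : Finset σ) (fun j => (X j : MvPolynomial σ R))
      (fun _ => 1) fun j _ => isHomogeneous_X R j
    simpa only [Finset.sum_const, smul_eq_mul, mul_one, Finset.card_univ] using this
  simpa using (isHomogeneous_C σ ψ).mul hprod

/-- The Dwork pencil `Σᵢ xᵢᵈ - ψ ∏ᵢ xᵢ` is the invertible pencil of the Fermat matrix `d · 1`
(Katz 2009, §1; the sextic case is route `HodgeConjecture/DworkPrymHodge`). [folklore] -/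
theorem pencil_diagonal [DecidableEq σ] (d : ℕ) (ψ : R) :
    pencil R (Matrix.diagonal fun _ : σ => d) ψ =
      (∑ i, (X i : MvPolynomial σ R) ^ d) - C ψ * ∏ j, X j := by
  rw [pencil, polynomial_diagonal]

end Deformation

section Invertible

variable {n : ℕ}

/-- `F_A` is **quasi-homogeneous** with positive integer weights `r` and weighted degree `d`:
`Σⱼ rⱼ aᵢⱼ = d` for every row `i` (Doran et al. 2018, §1.2, second condition).
[cite: DoranEtAl2018, §1.2 (quasi-homogeneity)] -/
def IsQuasiHomogeneousWith (A : Matrix (Fin n) (Fin n) ℕ) (r : Fin n → ℕ) (d : ℕ) : Prop :=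
  (∀ j, 0 < r j) ∧ ∀ i, ∑ j, r j * A i j = d

/-- The **critical locus** of `F_A : ℂⁿ → ℂ`: the common zeros in `ℂⁿ` of all the partial
derivatives `∂F_A/∂xⱼ` (the singular points of the function `F_A`). [folklore] -/
def criticalLocus (A : Matrix (Fin n) (Fin n) ℕ) : Set (Fin n → ℂ) :=
  {x | ∀ j, MvPolynomial.eval x (pderiv j (polynomial ℂ A)) = 0}

/-- Membership in the critical locus. [folklore] -/
theorem mem_criticalLocus_iff (A : Matrix (Fin n) (Fin n) ℕ) (x : Fin n → ℂ) :
    x ∈ criticalLocus A ↔ ∀ j, MvPolynomial.eval x (pderiv j (polynomial ℂ A)) = 0 :=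
  Iff.rfl

end Invertible

end Delsarte

/-- **Invertible polynomial** (Berglund–Hübsch–Krawitz; Doran–Kelly–Salerno–Sperber–Voight–
Whitcher 2018, §1.2). A square matrix of exponents `A ∈ Mₙ(ℤ_{≥0})` defines an invertible
polynomial `F_A = Σᵢ ∏ⱼ xⱼ ^ aᵢⱼ` when (i) `det A ≠ 0`; (ii) `F_A` is quasi-homogeneous: there
are `r₀, …, r_{n-1} ∈ ℤ_{>0}` and `d` with `Σⱼ rⱼ aᵢⱼ = d` for all `i`; (iii) the function
`F_A : ℂⁿ → ℂ` has exactly one singular point, at the origin, i.e. its critical locus is `{0}`.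
By Kreuzer–Skarke such an `F_A` is a Thom–Sebastiani sum of Fermat, loop and chain polynomials,
and the transpose `Aᵀ` is again invertible (BHK mirror `F_{Aᵀ} = Delsarte.polynomial _ Aᵀ`)
(loc. cit.). See `isInvertiblePolynomial_diagonal` for the Fermat type `Σ xᵢᵐ`, `m ≥ 2`.
[cite: DoranEtAl2018, §1.2 (definition of invertible polynomial)] -/
def IsInvertiblePolynomial {n : ℕ} (A : Matrix (Fin n) (Fin n) ℕ) : Prop :=
  (A.map (Nat.cast : ℕ → ℤ)).det ≠ 0 ∧
    (∃ (r : Fin n → ℕ) (d : ℕ), Delsarte.IsQuasiHomogeneousWith A r d) ∧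
      Delsarte.criticalLocus A = {0}

/-- The diagonal exponent matrix `m · 1` has determinant `mⁿ ≠ 0` for `m ≠ 0`. [folklore] -/
theorem Delsarte.det_map_diagonal_ne_zero {n m : ℕ} (hm : m ≠ 0) :
    ((Matrix.diagonal fun _ : Fin n => m).map (Nat.cast : ℕ → ℤ)).det ≠ 0 := by
  rw [Matrix.diagonal_map (Nat.cast_zero), Matrix.det_diagonal]
  simp [Finset.prod_const, hm]

/-- **The Fermat polynomial `Σᵢ xᵢᵐ`, `m ≥ 2`, is invertible** (the atomic "Fermat type" of
Kreuzer–Skarke; Doran et al. 2018, §1.2): `det (m·1) = mⁿ ≠ 0`, weights `rⱼ = 1`, `d = m`, and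
`∂ⱼ = m xⱼ^{m-1}` vanish simultaneously only at `x = 0`. [cite: DoranEtAl2018, §1.2 (Fermat type x^a)] -/
theorem isInvertiblePolynomial_diagonal {n m : ℕ} (hm : 2 ≤ m) :
    IsInvertiblePolynomial (Matrix.diagonal fun _ : Fin n => m) := by
  refine ⟨Delsarte.det_map_diagonal_ne_zero (by omega), ⟨fun _ => 1, m, fun _ => one_pos,
    fun i => ?_⟩, ?_⟩
  · rw [Finset.sum_eq_single i (fun j _ hji => by simp [Matrix.diagonal_apply_ne _ hji.symm])
      (fun h => absurd (Finset.mem_univ i) h)]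
    simp
  · ext x
    simp only [Delsarte.mem_criticalLocus_iff, Delsarte.polynomial_diagonal,
      Delsarte.pderiv_sum_X_pow, map_mul, map_natCast, map_pow, eval_X, Set.mem_singleton_iff,
      mul_eq_zero, Nat.cast_eq_zero]
    constructor
    · intro h
      funext j
      rcases h j with h0 | hpow
      · omega
      · exact eq_zero_of_pow_eq_zero hpow
    · rintro rfl j
      right
      simp only [Pi.zero_apply]
      exact zero_pow (by omega)

section Schemes

open _root_.CategoryTheory _root_.AlgebraicGeometry

variable {k : Type u} [Field k]

/-- The Fermat polynomial of `Motives/Sweep1` is the Delsarte polynomial of the diagonal matrix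
`m · 1` on `n + 2` variables. [folklore] -/
theorem Delsarte.polynomial_diagonal_eq_fermatPolynomial (n m : ℕ) :
    Delsarte.polynomial k (Matrix.diagonal fun _ : Fin (n + 2) => m) = fermatPolynomial k n m := by
  rw [Delsarte.polynomial_diagonal]
  rfl

/-- `X` *is a Delsarte hypersurface of dimension `n`* (Shioda 1986; Kloosterman 2017, Def. 2.1 and
2.5, in the case of a constant weight vector, i.e. `X_A ⊆ ℙⁿ⁺¹`): there is a square exponent matrix
`A ∈ M_{n+2}(ℤ_{≥0})` — as many monomials as variables — with `det A ≠ 0`, all row sums equal to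
some `e > 0` (so `F_A` is a form of degree `e`, and `A⁻¹(1,…,1)ᵀ = e⁻¹(1,…,1)ᵀ` has positive
entries), and a zero in each column (no variable divides `F_A`, Def. 2.1), such that `X` is the
reduced hypersurface `V₊(F_A) ⊆ ℙⁿ⁺¹_k` (`IsHypersurfaceCutOutBy` of `Motives/Sweep1`).
[cite: Kloosterman2017, Def. 2.1 and Def. 2.5 (Delsarte hypersurface)] -/
def IsDelsarteHypersurface (n : ℕ) (X : SchemeOver k) : Prop :=
  ∃ (A : Matrix (Fin (n + 2)) (Fin (n + 2)) ℕ) (e : ℕ), 0 < e ∧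
    (A.map (Nat.cast : ℕ → ℤ)).det ≠ 0 ∧ (∀ i, ∑ j, A i j = e) ∧ (∀ j, ∃ i, A i j = 0) ∧
      IsHypersurfaceCutOutBy (n + 1) (Delsarte.polynomial k A) X

/-- **Fermat varieties are Delsarte hypersurfaces**: `Xⁿₘ = V₊(F_{m·1})` with `det (m·1) = mⁿ⁺² ≠ 0`,
row sums `m` and off-diagonal zeros in every column (`m ≥ 1`). [folklore] -/
theorem IsFermatVariety.isDelsarteHypersurface {n m : ℕ} {X : SchemeOver k}
    (h : IsFermatVariety n m X) (hm : 0 < m) : IsDelsarteHypersurface n X := by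
  refine ⟨Matrix.diagonal fun _ => m, m, hm, Delsarte.det_map_diagonal_ne_zero hm.ne', ?_, ?_, ?_⟩
  · intro i
    rw [Finset.sum_eq_single i (fun j _ hji => Matrix.diagonal_apply_ne _ hji.symm)
      (fun h => absurd (Finset.mem_univ i) h), Matrix.diagonal_apply_eq]
  · intro j
    refine ⟨j + 1, Matrix.diagonal_apply_ne _ ?_⟩
    rw [Ne, add_eq_left, Fin.one_eq_zero_iff]
    omega
  · rwa [Delsarte.polynomial_diagonal_eq_fermatPolynomial]

/-- **Non-vacuity**: the reduced hypersurface `V₊(x₀ᵐ + ⋯ + x_{n+1}ᵐ) ⊆ ℙⁿ⁺¹_k` of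
`Motives/SmoothHypersurfaceScheme` is a Delsarte hypersurface whenever `m ≠ 0` in `k`
(`SmoothHypersurface.isHypersurfaceCutOutBy_hypersurface`, Fermat form nonsingular). [folklore] -/
theorem isDelsarteHypersurface_hypersurface_fermat {n m : ℕ} (hmk : (m : k) ≠ 0) :
    IsDelsarteHypersurface n (SmoothHypersurface.hypersurface (fermatPolynomial k n m)) := by
  have hm : 0 < m := Nat.pos_of_ne_zero fun h => hmk (by simp [h])
  refine IsFermatVariety.isDelsarteHypersurface ?_ hm
  exact SmoothHypersurface.isHypersurfaceCutOutBy_hypersurface (fermatPolynomial k n m)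
    (isHomogeneous_fermatPolynomial n m) (SmoothHypersurface.isNonsingularForm_sum_X_pow hmk) hm

namespace Delsarte

/-- The `l`-th equation of a Delsarte complete intersection: the sum of the monomials (rows of
`A`) assigned to block `l` by `blk`. [folklore] -/
def blockPolynomial {N r : ℕ} (A : Matrix (Fin (N + 1)) (Fin (N + 1)) ℕ)
    (blk : Fin (N + 1) → Fin r) (l : Fin r) : MvPolynomial (Fin (N + 1)) k :=
  ∑ i ∈ Finset.univ.filter (fun i => blk i = l), ∏ j, X j ^ A i j

/-- The block equations sum to `F_A`. [folklore] -/
theorem sum_blockPolynomial {N r : ℕ} (A : Matrix (Fin (N + 1)) (Fin (N + 1)) ℕ)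
    (blk : Fin (N + 1) → Fin r) :
    ∑ l, blockPolynomial (k := k) A blk l = polynomial k A := by
  unfold blockPolynomial polynomial
  rw [← Finset.sum_fiberwise_of_maps_to (g := blk) (fun i _ => Finset.mem_univ (blk i))]

/-- If the rows in block `l` all have row sum `e l`, the block equation `F_l` is a form of degree
`e l`. [folklore] -/
theorem isHomogeneous_blockPolynomial {N r : ℕ} {A : Matrix (Fin (N + 1)) (Fin (N + 1)) ℕ}
    {blk : Fin (N + 1) → Fin r} {e : Fin r → ℕ} (h : ∀ i, ∑ j, A i j = e (blk i)) (l : Fin r) :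
    (blockPolynomial (k := k) A blk l).IsHomogeneous (e l) := by
  refine IsHomogeneous.sum _ _ _ fun i hi => ?_
  rw [Finset.mem_filter] at hi
  rw [← hi.2, ← h i]
  refine IsHomogeneous.prod _ _ _ fun j _ => ?_
  simpa using (isHomogeneous_X k j).pow (A i j)

/-- With a single block, the block equation is `F_A` itself. [folklore] -/
theorem blockPolynomial_of_subsingleton {N : ℕ} (A : Matrix (Fin (N + 1)) (Fin (N + 1)) ℕ)
    (blk : Fin (N + 1) → Fin 1) (l : Fin 1) :
    blockPolynomial (k := k) A blk l = polynomial k A := by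
  unfold blockPolynomial polynomial
  refine Finset.sum_congr ?_ fun _ _ => rfl
  ext i
  simp [Subsingleton.elim (blk i) l]

end Delsarte

/-- `X` *is a Delsarte complete intersection of codimension `r` in `ℙᴺ_k`*: there are a square
exponent matrix `A ∈ M_{N+1}(ℤ_{≥0})` with `det A ≠ 0` — in total as many monomials as
variables — and an assignment `blk` of its rows (monomials) to `r` nonempty blocks such that the
`l`-th block equation `F_l = Σ_{blk i = l} ∏ⱼ xⱼ ^ aᵢⱼ` is a form of some degree `e_l > 0`, `X` is
the reduced subscheme of `ℙᴺ_k` cut out by `F_1, …, F_r` (`IsCutOutBy` of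
`Motives/CompleteIntersection`), and `X` has the expected dimension `N - r` (`schemeDim`, i.e.
the `F_l` meet properly). For `r = 1` this is `IsDelsarteHypersurface` without the column
condition (`IsDelsarteHypersurface.isDelsarteCompleteIntersection`); the case `r > 1` is the
componentwise extension asked for by route `HodgeConjecture/KatzUnwinding` (towers of cyclic covers
and Fermat base changes of invertible pencils, each step adjoining one variable and one binomial or
Fermat relation) and is NOT a notion taken from print.
[cite: Kloosterman2017, Def. 2.1 and 2.5 (r = 1); r > 1 is the route's componentwise extension] -/
def IsDelsarteCompleteIntersection (N r : ℕ) (X : SchemeOver k) : Prop :=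
  ∃ (A : Matrix (Fin (N + 1)) (Fin (N + 1)) ℕ) (blk : Fin (N + 1) → Fin r) (e : Fin r → ℕ),
    Function.Surjective blk ∧ (∀ l, 0 < e l) ∧ (A.map (Nat.cast : ℕ → ℤ)).det ≠ 0 ∧
      (∀ i, ∑ j, A i j = e (blk i)) ∧
        IsCutOutBy N (Delsarte.blockPolynomial (k := k) A blk) X ∧ schemeDim X.left + r = N

/-- A Delsarte hypersurface of dimension `n` (which has dimension `n` as a scheme) is a Delsarte
complete intersection of codimension `1` in `ℙⁿ⁺¹`: one block. (The dimension hypothesis is the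
named fact `schemeDim_eq` of `Motives/Varieties` when `X` is smooth projective of dimension `n`.)
[folklore] -/
theorem IsDelsarteHypersurface.isDelsarteCompleteIntersection {n : ℕ} {X : SchemeOver k}
    (h : IsDelsarteHypersurface n X) (hdim : schemeDim X.left = n) :
    IsDelsarteCompleteIntersection (n + 1) 1 X := by
  obtain ⟨A, e, he, hdet, hrow, -, hcut⟩ := h
  refine ⟨A, fun _ => 0, fun _ => e, fun l => ⟨0, (Subsingleton.elim _ _)⟩, fun _ => he, hdet,
    fun i => hrow i, ?_, by rw [hdim]⟩
  have hF : Delsarte.blockPolynomial (k := k) A (fun _ => (0 : Fin 1)) =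
      fun _ => Delsarte.polynomial k A :=
    funext fun l => Delsarte.blockPolynomial_of_subsingleton A _ l
  rw [hF, isCutOutBy_const_iff]
  exact hcut

/-- **Fermat cover of a Delsarte hypersurface** (Shioda 1986; Bini 2011, Thm. 3.1 = Kelly 2013,
Thm. 3.1; Kloosterman 2017, §2). Let `A ∈ M_{n+2}(ℤ_{≥0})` have `det A ≠ 0`, constant row sums
`e > 0` and a zero in each column, let `d > 0` be such that `B = d A⁻¹` is integral (`A B = d · 1`),
let `X = V₊(F_A) ⊆ ℙⁿ⁺¹_ℂ` be the Delsarte hypersurface and `Y = Xⁿ_d : Σ yᵢᵈ = 0` the Fermat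
variety in `ℙⁿ⁺¹_ℂ`. The Shioda map `φ_B : y ↦ x`, `xⱼ = ∏ₖ yₖ ^ bⱼₖ`, satisfies
`F_A(φ_B(y)) = Σᵢ yᵢᵈ` (`Delsarte.bind₁_polynomial`) and restricts to a rational map `Y ⇢ X`; in
print: "`X_A` is birational to the quotient of the Fermat variety `X_{dI}` by the finite diagonal
group `((φ_B)_*)⁻¹(J_{F_A})/J_{F_{dI}}`" (Kelly, Thm. 3.1) and "the quotient map defines
surjective morphisms `Y*_λ → X*_λ`" of torus parts, `X*` being dense in `X` because each column of
`A` has a zero (Kloosterman, §2, Lemma 2.4 and after Lemma 2.8; here `λ = 0`).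
**Vendored consequence** (Mathlib has rational maps, `Scheme.PartialMap`, but no quotients of
varieties by finite groups): there is a dominant rational map of `ℂ`-schemes from `Y` to `X`
(a morphism from a dense open of `Y`, compatible with the structure maps to `Spec ℂ`). A named
fact (`def … : Prop`, D-0014), weaker than the printed birationality to the quotient.
[cite: Kelly2013, Thm. 3.1 (= Bini2011 Thm. 3.1); Kloosterman2017 §2 (Y* → X* surjective)] -/
def DelsarteFermatCover : Prop :=
  ∀ ⦃n d : ℕ⦄ (A : Matrix (Fin (n + 2)) (Fin (n + 2)) ℕ) (B : Matrix (Fin (n + 2)) (Fin (n + 2)) ℤ)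
    ⦃X Y : SchemeOver ℂ⦄, 0 < d → A.map (Nat.cast : ℕ → ℤ) * B = (d : ℤ) • (1 : Matrix _ _ ℤ) →
    (∀ j, ∃ i, A i j = 0) → (∃ e, 0 < e ∧ ∀ i, ∑ j, A i j = e) →
    IsHypersurfaceCutOutBy (n + 1) (Delsarte.polynomial ℂ A) X → IsFermatVariety n d Y →
    ∃ f : Y.left.PartialMap X.left, IsDominant f.hom ∧ f.hom ≫ X.hom = f.domain.ι ≫ Y.hom

end Schemes

end Literature.AlgebraicGeometry.Motives
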